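import Literature.Analysis.FunctionSpaces.KMSStatesGroundStateProofs
import Literature.Analysis.FunctionSpaces.KMSStatesGroundStatesEqCounterexample
import HarnessLib

/-!
# `kmsGroundStates τ = {ω | ω.IsGroundState τ}`: discharge at every C⋆-ordered algebra

The named fact `Literature.Analysis.FunctionSpaces.kmsGroundStates_eq`
(`Literature/Analysis/FunctionSpaces/KMSStates.lean`; Bratteli–Robinson II Prop. 5.3.19: the
analytic, `β = +∞` KMS, ground states `kmsGroundStates τ` of a C⋆-dynamical system `(A, τ)` are
exactly the ground states in the generator form `-i ω(a⋆ δ(a)) ≥ 0`, Bratteli–Robinson II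
Def. 5.3.18, Sakai (1991) Def. 4.2.1) is a `def … : Prop` whose parameters are the section
implicits `{A} [CStarAlgebra A] [PartialOrder A] {τ}` of `KMSStates.lean`, i.e. a `Prop` family
indexed in particular by an ARBITRARY partial order on `A`, for which
`Literature.MathematicalPhysics.QuantumLattice.State A` (monotone linear `ω` with `ω 1 = 1`) need
not consist of positive functionals.

Contents:
* `Literature.Analysis.FunctionSpaces.kmsGroundStates_eq_holds`: the family holds at every
  C⋆-ordered `A` — `[StarOrderedRing A]` as a section instance: the order of `A` IS the C⋆-order,
  so that `State A` is the set of genuine states, the source's setting — for every automorphism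
  group `τ`; this is Bratteli–Robinson II Prop. 5.3.19 in its printed generality, obtained from the
  sorry-free theorem
  `Literature.MathematicalPhysics.QuantumLattice.State.kmsGroundStates_eq_setOf_isGroundState`
  (`KMSStatesGroundStateProofs.lean`, through the equivalence
  `Literature.MathematicalPhysics.QuantumLattice.State.isGroundState_iff_isKMSGroundState'`).
  Same pattern as the discharge
  `Literature.MathematicalPhysics.QuantumLattice.State.isKMSState_iff_entire_holds` of the
  sister fact `State.isKMSState_iff_entire` (`KMSStatesProofs.lean`).
* Sharpness (`namespace KMSGroundStateCounterexample`): the bare universal closure of the family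
  over all partial orders is false — refuted, sorry-free, by
  `Literature.Analysis.FunctionSpaces.KMSGroundStateCounterexample.not_kmsGroundStates_eq`
  (`KMSStatesGroundStatesEqCounterexample.lean`: `A = DiscreteB2 = B(ℂ²)` with the DISCRETE order,
  the inner dynamics of the projection `E₀₀`, the non-positive normalised functional
  `ω(x) = x₁₁ + x₀₁`). Here `not_kmsGroundStates_eq_discreteB2` records the failing index of the
  family explicitly, and `not_starOrderedRing_discreteB2` that the discrete order of `DiscreteB2`
  admits no `StarOrderedRing` structure (`0 ≤ 1⋆ 1 = 1` would force `0 = 1`), so the hypothesis of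
  `kmsGroundStates_eq_holds` fails exactly there: the discharge and the refutation live in this one
  (consistent, axiom-whitelisted) environment.

What a consumer gets. A hypothesis `(h : kmsGroundStates_eq)` in a context carrying
`[StarOrderedRing A]` is fed `kmsGroundStates_eq_holds`; without that instance no discharge exists,
and none can (`not_kmsGroundStates_eq`). New statements should use
`State.kmsGroundStates_eq_setOf_isGroundState` directly.

Deliberately NOT here: no new definitions and no new named facts; the un-primed fact is not
edited (its docstring in `KMSStates.lean` already flags the mis-statement); nothing on KMS states at
finite `β`.

Sources: O. Bratteli, D. W. Robinson, *Operator Algebras and Quantum Statistical Mechanics II*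
(2nd ed., Springer 1997), Def. 5.3.18, Prop. 5.3.19; S. Sakai, *Operator Algebras in Dynamical
Systems* (Cambridge UP 1991), Def. 4.2.1 (p. 107: "a state `φ` on `A` is said to be a ground state
for `{A, α}` if `-iφ(a⋆δ(a)) ≥ 0` for `a ∈ 𝒟(δ)`"), Prop. 4.2.3 (p. 108), Prop. 4.3.5 (p. 117, the
`β = +∞` case: bounded holomorphic `F_{a,b}` on the upper half-plane with
`F_{a,b}(t) = φ(a α_t(b))`); O. Bratteli, D. W. Robinson, *Operator Algebras and Quantum
Statistical Mechanics I* (2nd ed., Springer 1987), §2.3.2 (states are positive normalised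
functionals).
-/

noncomputable section

namespace Literature.Analysis.FunctionSpaces

section Discharge

variable {A : Type*} [CStarAlgebra A] [PartialOrder A] [StarOrderedRing A]
  {τ : ℝ → (A ≃⋆ₐ[ℂ] A)}

/-- **Discharge of the named fact `kmsGroundStates_eq` at every C⋆-ordered `A`**
(Bratteli–Robinson II Prop. 5.3.19; Sakai (1991) Def. 4.2.1, Prop. 4.3.5): for a unital
C⋆-algebra `A` with its C⋆-order (`[StarOrderedRing A]`, so that
`Literature.MathematicalPhysics.QuantumLattice.State A` is the set of states of `A`) and a strongly
continuous one-parameter group `τ` of ⋆-automorphisms, the analytic (`β = +∞` KMS) ground states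
are exactly the ground states in the generator form:
`kmsGroundStates τ = {ω | ω.IsGroundState τ}`.

**Scope — read before consuming.** `kmsGroundStates_eq` (`KMSStates.lean`) is a `Prop` family
indexed by the section implicits `{A} [CStarAlgebra A] [PartialOrder A] {τ}`, in particular by an
*arbitrary* partial order on `A`. Its bare universal closure over all partial orders is **false**
(`KMSGroundStateCounterexample.not_kmsGroundStates_eq`, and the explicit failing index
`KMSGroundStateCounterexample.not_kmsGroundStates_eq_discreteB2` below: `B(ℂ²)` with the discrete
order). The source's statement concerns states of the C⋆-algebra (positive functionals), and
positivity is what the printed proof uses (`t ↦ ω(a⋆ τ_t(a))` positive-definite, `H_ω ≥ 0`).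
Accordingly this theorem sits in a section carrying `[StarOrderedRing A]` as a section instance —
exactly like `State.isKMSState_iff_entire_holds` (`KMSStatesProofs.lean`) — and proves the family at
every C⋆-ordered `A` and every `τ`, the full generality of the source; nothing is claimed for
other orders (where `KMSGroundStateCounterexample.not_starOrderedRing_discreteB2` shows the instance
hypothesis indeed fails at the counterexample). The proof is the sorry-free corrected theorem
`State.kmsGroundStates_eq_setOf_isGroundState` (`KMSStatesGroundStateProofs.lean`).
[cite: BratteliRobinsonII1997, Prop. 5.3.19] -/
theorem kmsGroundStates_eq_holds : kmsGroundStates_eq (A := A) (τ := τ) :=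
  fun hτ =>
    Literature.MathematicalPhysics.QuantumLattice.State.kmsGroundStates_eq_setOf_isGroundState hτ

end Discharge

/-! ### Sharpness: the failing index, and why the discharge does not reach it -/

namespace KMSGroundStateCounterexample

/-- **The family `kmsGroundStates_eq` fails at an explicit index**: for `A = DiscreteB2`
(`B(ℂ²)` with the discrete order) and the inner dynamics `τ` of the projection `E₀₀`,
`kmsGroundStates τ ≠ {ω | ω.IsGroundState τ}` — the normalised, non-positive functional `badState`
(`ω(x) = x₁₁ + x₀₁`) is an analytic ground state (`isKMSGroundState_badState`) but violates the
generator condition (`not_isGroundState_badState`). Pointwise form of `not_kmsGroundStates_eq` /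
`exists_kmsGroundStates_ne` (`KMSStatesGroundStatesEqCounterexample.lean`); elementary linear
algebra. [folklore] -/
theorem not_kmsGroundStates_eq_discreteB2 :
    ¬ Literature.Analysis.FunctionSpaces.kmsGroundStates_eq (A := DiscreteB2)
        (τ := projDynamics proj isStarProjection_proj) := by
  intro h
  have hmem : badState ∈ kmsGroundStates (projDynamics proj isStarProjection_proj) :=
    isKMSGroundState_badState
  rw [h (isAutomorphismGroup_projDynamics proj isStarProjection_proj)] at hmem
  exact not_isGroundState_badState hmem

/-- **The discrete order of `DiscreteB2` is not a star order**: there is no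
`StarOrderedRing DiscreteB2` structure (for the discrete partial order
`DiscreteB2.instPartialOrder`). Indeed a star order has `0 ≤ 1⋆ 1 = 1`
(`star_mul_self_nonneg`), which for the discrete order means `0 = 1` in `B(ℂ²)`; applying the
normalised linear functional `badState` gives `0 = 1` in `ℂ`. Hence the instance hypothesis of
`kmsGroundStates_eq_holds` fails at the counterexample of `not_kmsGroundStates_eq_discreteB2`,
as it must. [folklore] -/
theorem not_starOrderedRing_discreteB2 : ¬ StarOrderedRing DiscreteB2 := by
  intro h
  have h01 : (0 : DiscreteB2) ≤ 1 := by
    have h11 := star_mul_self_nonneg (1 : DiscreteB2)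
    rwa [star_one, mul_one] at h11
  have h01' : (0 : DiscreteB2) = 1 := h01
  have h := congrArg badState h01'
  rw [map_zero, Literature.MathematicalPhysics.QuantumLattice.State.map_one] at h
  exact zero_ne_one h

end KMSGroundStateCounterexample

end Literature.Analysis.FunctionSpaces
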